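import Mathlib
import Summits.Langlands.Langlands.Theses.PhantomRMYoshida
import Summits.Langlands.Langlands.Theorems.PhantomRMYoshidaStableYoshidaCongruenceRankPropagation
import Summits.Langlands.Langlands.Theorems.PhantomRMYoshidaStableYoshidaCongruenceInvariantSubspaceFinrankTwo

/-!
# Line `paramodular-purity-torsion-locus` — skeleton for crux `PhantomRMYoshida.StableYoshidaCongruence`
# (stmt-Langlands-13640, route-Langlands-PhantomRMYoshida; crux-plan, round 1, gen 1)

**Idea** (crux-idea card `paramodular-purity-torsion-locus`, ideator 1; triage r1: fail / pass / pass —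
"a faithful REDUCTION, not an engine; K1 (purity) and K3 (wall transfer) correct and provable from print,
K2 = the crux").  Work at PARAMODULAR tame level `K(N)` and Klingen level at `p`, at the Yoshida-type
maximal ideal `𝔪 = 𝔪(σ̄ ⊕ σ̄', red)` of the Hecke algebra acting on the Klingen higher-Hida complex
`M = e(U) RΓ(𝔛_{K(N) Kli(p^∞)}, Ω^{κ}(-D))` of Pilloni / Boxer–Calegari–Gee–Pilloni (arXiv:1812.09269,
held-text Thm 156: a PERFECT complex of `Λ₁ = ℤ_p⟦T⟧`-modules of amplitude `[0,1]` interpolating the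
cuspidal Klingen-ordinary weights `(k,2)`, `k ≡ 2 (mod p-1)`; held-text Thm 255: after inverting `p`,
`M ⊗^L κ_{(k,2)}` IS classical cuspidal Klingen-ordinary coherent cohomology of weight `(k,2)` at level
`K(N)K_p(I)`, for EVERY `k ≥ 2` including the wall `(2,2)`).  Two levers:
(K1, SIGN PURITY) every HOLOMORPHIC weight-`(k,2)` eigenclass at `𝔪` at level `K(N)Kli(p)` is of general
type — a holomorphic Yoshida member needs an odd number of finite non-generic places (Arthur's
multiplicity formula), tempered non-generic representations are not paramodular (Roberts–Schmidt /
JLRS Thm 2.3.3) and have no Klingen-parahoric vectors at `p` (`VIb`: dims `K 0 / K(p) 0 / Kli(p) 0 /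
Si(p) 1 / I 1`; `Va`'s partner is supercuspidal), CAP types (P),(B) and characters are excluded because
`σ̄, σ̄'` are irreducible, and Soudry type (Q) needs `σ̄' ≅ σ̄ ⊗ ε̄^{±1}` with equal determinants, i.e.
`p = 3` cyclotomic-twist pairs (carved out: `TwistEps`); so a classical point of `M_𝔪` at ANY Klingen
weight yields an irreducible(-ish), `GL₄`-cuspidal, Greenberg-ordinary symplectic `ρ` — stability,
transfer and shape for free;
(K3, WALL TRANSFER) `H⁰(M_𝔪) = ker(F⁰ → F¹)` is TORSION-FREE, so `rank_{Λ₁} H⁰(M_𝔪) > 0` — equivalently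
(finiteness of `Ass H¹(M_𝔪)[1/p]` over the PID `Λ₁[1/p]`) classical points at INFINITELY MANY Klingen
weights — forces a classical point at EVERY weight, in particular at the wall `(2,2)` (the card's
"one class at one weight propagates" corrected to "infinitely many weights propagate", triage r1-2 (i),
r1-3 (1)).  K2, the locus statement "`P_{(2,2)} ∈ Supp H⁰(M_𝔪 ⊗^L κ_{(2,2)})[1/p]` for some `N`", is the
crux at paramodular level and is NOT claimed: off the family sector it is the honest remainder (Stub 4).

**Typing** (the tree has no Siegel-threefold / paramodular / Hecke-module vocabulary).  The coherent
objects enter through ONE existential, `stub_klingenWallModel`: the `𝔪`-localised, `p`-inverted Klingen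
complex is posited as an abstract two-term complex `[M --d--> N]` of finite free modules over a PID `R`
(`= Λ_{𝒪}[1/p]`, a one-dimensional Noetherian UFD) with weight elements `ϖ m = T - u_m` (pairwise
coprime non-units along the Klingen line `Wt p = {m ≥ 1, m ≡ 1 (p-1)}`, weight `(k,2) = (m+1,2)`), tied
to reality by a TWO-WAY DICTIONARY stated purely over existing Galois/`GL_n` declarations:
(a) a point `ker(d mod ϖ m) ≠ 0` ⇒ weight `m` is automorphic (`AutWt m`: an `ShW m`-shaped `r` —
symplectic `ε^{-m}`, Greenberg `(0,0,m,m)` distinguished, residual pair `(σ̄,σ̄')` — cuspidal-automorphic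
on `GL₄`; = classicality + K1 + Galois representations + transfer, IN PRINT modulo assembly), and
(a') weight `m` automorphic at bounded level `S` (`Fam S m`) ⇒ a point at `ϖ m` (the CONVERSE dictionary —
`GL₄ → GSp₄` descent + archimedean weight + conductor for a `π` known only through a.e. Satake matching:
a RECIPROCITY FRAGMENT, true under Langlands, not in print for non-regular `π`; flagged as the soft spot
of Stub 1).  Logically (given Stub 2 and small "fake" models) Stub 1 is EQUIVALENT to the pure Galois-side
WEIGHT DICHOTOMY `familyDichotomy` proved below from Stubs 1–2: at each level `S`, the automorphic Klingen
weights of the pair are FINITELY MANY, or EVERY Klingen weight is automorphic.  That dichotomy is the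
exact Galois shadow of "perfect amplitude `[0,1]` + torsion-free `H⁰`", and it is NOT implied by the crux
(which speaks of the wall weight only) — no costume; Stub 4 is the crux restricted off the sector, as in
the three sibling lines.

## Shape (data flow of `StableYoshidaCongruence_of`, sorry-free glue at the end of the file)

* `stub_klingenWallModel` (S1, XL; (a) in print modulo named facts, (a') reciprocity fragment) — for an
  eligible pair off `TwistEps` and every finite `S`: a wall model `IsWallModel (Wt p) (AutWt …) (Fam … S) d ϖ`.
* `stub_rankPropagation` (S2, M/L, PROVABLE NOW, Mathlib only) — two-term complex of finite free modules
  over a PID, pairwise coprime non-units `ϖ m`: points at infinitely many `ϖ m` ⇒ a point at EVERY non-unit.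
* `stub_irreducibleOfCuspidalGL4` (S3, L modulo Kisin FM / Pilloni–Stroh / Jacquet–Shalika) — VERBATIM the
  sibling line `serre-dual-ribet-square`'s Stub 3 (shared lemma: same name, same statement).
* `stub_offFamilyRemainder` (S4, OPEN — the remainder, not attacked): off the family sector
  (`TwistEps`, or finitely many automorphic Klingen weights at every level) the wall weight is automorphic.
* glue: `familyDichotomy` (S1 + S2: finite or all) ⇒ in the sector `AutWt 1`; off it S4; then S3.

**Disproof used** (`Cruxes/StableYoshidaCongruence/Disproof.lean`, cdisprove cycle 3, read in full):
§2 `exists_cuspForm_of_not_crux` — automorphic wall, NO `_false_without_H` theorem exists for any `H`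
(nothing to honour by name; stated so the lead does not look for one); §4 `loadBearing` — H5 (`∃ ρ, Sh ρ`)
is THE load-bearing hypothesis and certifies only the REDUCIBLE witness: honoured — "the line uses H5 at
`stub_klingenWallModel`" exactly as "`𝔪` is ordinary and `p`-distinguished" (needed for the Klingen Hida
family and for the `IsResiduallyDistinguishedAt` clause of (a)), never as an irreducible point; H1/H1'
(`AutGL2`) decoration — threaded, unused; §3.2 `sector_iff_irr'` (Irr'-trap) — avoided: no stub takes an
irreducible witness, the family sector is defined by automorphic WEIGHTS, not by the witness; §3.3
`crux_iff_lifting` — consistent: (a) CONSTRUCTS the lift from a coherent class; §5 R1/D1 — the functorial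
pairs are expected to be exactly the family sector (Deo–Palvannan arXiv:2602.20737 rigidity; recorded,
not used); §5 R2 (`p = 3`) — untouched (the `p = 3` cyclotomic-twist pairs go to S4, all other `p = 3`
pairs are treated like `p ≥ 5`); §6 (expected dimension `-1`, accidents) — is S4's recorded status.  No
`Negative/` lemma has landed for this crux (nothing to import); negatives index
(`ledger negatives --problem Langlands`): 1 entry (K3 Kuga–Satake anchor), unrelated; no stub is an
instance of a refuted statement.
-/

open IsDedekindDomain
open scoped NumberField
open Literature.NumberTheory.GaloisRepresentations Literature.NumberTheory.Automorphic
open Summit.Langlands.Langlands.Theses.PhantomRMYoshida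

noncomputable section

namespace Summit.Langlands.Langlands.Cruxes.StableYoshidaCongruence.ParamodularPurityTorsionLocus

set_option linter.dupNamespace false

/-! ## Vocabulary I — the crux unfolded into named pieces (verbatim Disproof.lean §0) -/

section Names

variable (p : ℕ) [Fact p.Prime] (k : Type) [Field k] [CharP k p] [TopologicalSpace k]
  [DiscreteTopology k]

/-- `ε̄ : Γ_ℚ → (ℤ/p)ˣ`, the mod-`p` cyclotomic character exactly as spelled in the route file. -/
def epsBar : Field.absoluteGaloisGroup ℚ →* (ZMod p)ˣ :=
  (modularCyclotomicCharacter (AlgebraicClosure ℚ)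
      (HasEnoughRootsOfUnity.natCard_rootsOfUnity (AlgebraicClosure ℚ) p)).comp
    (MulSemiringAction.toRingAut (Field.absoluteGaloisGroup ℚ) (AlgebraicClosure ℚ))

/-- The multiplier function `g ↦ ε(g)⁻¹ ∈ ℚ̄_p` of the route (cohomological convention). -/
def invCyc : Field.absoluteGaloisGroup ℚ → PadicAlgCl p := fun g =>
  algebraMap ℚ_[p] (PadicAlgCl p)
    ((((GaloisRep.cyclotomicCharacter ℚ p g)⁻¹ : ℤ_[p]ˣ) : ℤ_[p]) : ℚ_[p])

variable {p k}

/-- `Sh red σ σ' r`: the SHAPE demanded by the crux — symplectic-`ε⁻¹`, Greenberg-ordinary `(0,0,1,1)` and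
residually distinguished at `p`, residual pair `(σ, σ')` through `red`.  Verbatim the route's `let Sh`
(third conjunct = `r.HasResidualPair red σ σ'` of `ResidualPair.lean`, definitionally). -/
def Sh (red : Valued.integer (PadicAlgCl p) →+* k) (σ σ' : FramedGaloisRep ℚ k 2)
    (r : FramedGaloisRep ℚ (PadicAlgCl p) 4) : Prop :=
  r.IsSymplecticWithMultiplierFun (invCyc p) ∧
  (∀ v : HeightOneSpectrum (NumberField.RingOfIntegers ℚ),
      ((p : ℕ) : NumberField.RingOfIntegers ℚ) ∈ v.asIdeal →
        r.IsGreenbergOrdinaryOfShapeAt v ![0, 0, 1, 1] ∧ r.IsResiduallyDistinguishedAt v ![0, 0, 1, 1]) ∧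
  (∀ᶠ v : HeightOneSpectrum (NumberField.RingOfIntegers ℚ) in Filter.cofinite,
      r.IsUnramifiedAt v ∧ σ.IsUnramifiedAt v ∧ σ'.IsUnramifiedAt v ∧
        ∃ (P : Polynomial (Valued.integer (PadicAlgCl p))) (P₁ P₂ : Polynomial k),
          r.HasFrobCharpolyAt v (P.map (Valued.integer (PadicAlgCl p)).subtype) ∧
            σ.HasFrobCharpolyAt v P₁ ∧ σ'.HasFrobCharpolyAt v P₂ ∧ P.map red = P₁ * P₂)

variable (p) in
/-- `ShW red σ σ' m r` — the KLINGEN-WEIGHT-`(m+1, 2)` SHAPE: symplectic with multiplier `ε^{-m}`,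
Greenberg-ordinary of shape `(0,0,m,m)` (unramified rank-2 block FIRST, the crux's orientation) and
residually distinguished at `p`, residual pair `(σ, σ')` through `red`.  `ShW … 1 r ↔ Sh … r`
(`shW_one_iff`, `x ^ 1 = x`).  It is the Galois shape of a Klingen-ordinary holomorphic Siegel eigenform of
general type and weight `(k, 2) = (m+1, 2)` at a `p`-distinguished Yoshida-type `𝔪`, in the twist
`ρ_{Π,p} ⊗ ε^{1-k/2}` of BCGP's normalisation (arXiv:1812.09269, held-text Thm 40/41: `ν ∘ ρ = ε⁻¹`, HT
`(k/2, k/2, 1-k/2, 1-k/2)`, ordinary diagonal `(λ_α ε^{k/2-1}, λ_β ε^{k/2-1}, λ_β⁻¹ ε^{-k/2}, λ_α⁻¹ ε^{-k/2})`;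
after the twist: multiplier `ε^{1-k} = ε^{-m}`, diagonal `(λ_α, λ_β, λ_β⁻¹ε^{-m}, λ_α⁻¹ε^{-m})`).  Only
`m ≡ 1 (mod p-1)` is compatible with `det σ̄ = det σ̄' = ε̄⁻¹` (`Wt p`). -/
def ShW (red : Valued.integer (PadicAlgCl p) →+* k) (σ σ' : FramedGaloisRep ℚ k 2) (m : ℕ)
    (r : FramedGaloisRep ℚ (PadicAlgCl p) 4) : Prop :=
  r.IsSymplecticWithMultiplierFun (fun g => invCyc p g ^ m) ∧
  (∀ v : HeightOneSpectrum (NumberField.RingOfIntegers ℚ),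
      ((p : ℕ) : NumberField.RingOfIntegers ℚ) ∈ v.asIdeal →
        r.IsGreenbergOrdinaryOfShapeAt v ![0, 0, m, m] ∧ r.IsResiduallyDistinguishedAt v ![0, 0, m, m]) ∧
  (∀ᶠ v : HeightOneSpectrum (NumberField.RingOfIntegers ℚ) in Filter.cofinite,
      r.IsUnramifiedAt v ∧ σ.IsUnramifiedAt v ∧ σ'.IsUnramifiedAt v ∧
        ∃ (P : Polynomial (Valued.integer (PadicAlgCl p))) (P₁ P₂ : Polynomial k),
          r.HasFrobCharpolyAt v (P.map (Valued.integer (PadicAlgCl p)).subtype) ∧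
            σ.HasFrobCharpolyAt v P₁ ∧ σ'.HasFrobCharpolyAt v P₂ ∧ P.map red = P₁ * P₂)

/-- `AutGL2 red s`: residual automorphy of `s : Γ_ℚ → GL₂(k)` on `GL₂` (verbatim the route's `let AutGL2`;
decoration modulo KW, Disproof §3.5 — threaded to Stubs 1 and 4, consumed by neither lever). -/
def AutGL2 (red : Valued.integer (PadicAlgCl p) →+* k) (s : FramedGaloisRep ℚ k 2) : Prop :=
  ∀ (hcpt₂ : isCompact_glFiniteIntegralLevel 2 ℚ) (ι : PadicAlgCl p ≃+* ℂ),
    ∃ π₂ : CuspidalAutomorphicRepData 2 ℚ hcpt₂, π₂.1.IsLAlgebraic ∧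
      ∀ᶠ v : HeightOneSpectrum (NumberField.RingOfIntegers ℚ) in Filter.cofinite,
        ∃ (a : Multiset ℂ) (P : Polynomial (Valued.integer (PadicAlgCl p))) (Pb : Polynomial k),
          π₂.1.HasSatakeParamAt v a ∧
            P.map (Valued.integer (PadicAlgCl p)).subtype = arithFrobPolyOfSatake ι v.residueCard 1 a ∧
              s.IsUnramifiedAt v ∧ s.HasFrobCharpolyAt v Pb ∧ P.map red = Pb

variable (p) in
/-- `AutGL4 hcpt ι r`: `r` is automorphic on `GL₄(𝔸_ℚ)` — a.e. Satake–Frobenius matching with an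
L-algebraic CUSPIDAL `π` (the route's inlined weak `IsAutomorphicAE` clause; cuspidality = stability). -/
def AutGL4 (hcpt : isCompact_glFiniteIntegralLevel 4 ℚ) (ι : PadicAlgCl p ≃+* ℂ)
    (r : FramedGaloisRep ℚ (PadicAlgCl p) 4) : Prop :=
  ∃ π : CuspidalAutomorphicRepData 4 ℚ hcpt, π.1.IsLAlgebraic ∧
    ∀ᶠ v : HeightOneSpectrum (NumberField.RingOfIntegers ℚ) in Filter.cofinite,
      ∃ a : Multiset ℂ, π.1.HasSatakeParamAt v a ∧ r.IsUnramifiedAt v ∧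
        r.HasFrobCharpolyAt v (arithFrobPolyOfSatake ι v.residueCard 1 a)

variable (p) in
/-- `DetCond σ σ'`: `det σ = ε̄⁻¹` and `det σ' = det σ`. -/
def DetCond (σ σ' : FramedGaloisRep ℚ k 2) : Prop :=
  ∀ g, FramedRep.det σ g = (Units.map (ZMod.castHom (dvd_refl p) k).toMonoidHom (epsBar p g))⁻¹ ∧
    FramedRep.det σ' g = FramedRep.det σ g

/-- `NonConj σ σ'`: `σ'` is not `GL₂(k)`-conjugate to `σ`. -/
def NonConj (σ σ' : FramedGaloisRep ℚ k 2) : Prop :=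
  ¬ ∃ g : GL (Fin 2) k, ∀ x, g * σ x * g⁻¹ = σ' x

variable (p) in
/-- `TwistEps σ σ'` — the CYCLOTOMIC-TWIST PAIRS: `tr σ'(x) = ε̄(x) · tr σ(x)` for all `x ∈ Γ_ℚ`.  For
irreducible `σ` over an algebraically closed `k` this is `σ' ≅ σ ⊗ ε̄` (Brauer–Nesbitt); with `DetCond`
it forces `ε̄² = 1`, i.e. `p = 3`.  These are exactly the pairs at which Soudry-type CAP representations
(BCGP arXiv:1812.09269 held-text Lemma 48, case (c): `μ|·|^{1/2} ⊞ μ|·|^{-1/2}`, `μ` dihedral, residually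
`σ̄_μ ⊕ σ̄_μ ε̄⁻¹`) and the Siegel-Eisenstein boundary are residually of type `𝔪`, the one place where sign
purity is unavailable (triage r1-2 (iii), r1-3 (2)): excluded from Stub 1, sent to Stub 4. -/
def TwistEps (σ σ' : FramedGaloisRep ℚ k 2) : Prop :=
  ∀ x, Matrix.trace (σ' x).val =
    ((Units.map (ZMod.castHom (dvd_refl p) k).toMonoidHom (epsBar p x) : kˣ) : k) *
      Matrix.trace (σ x).val

variable (p k) in
/-- The crux AT fixed outer data `(p, k, red, σ, σ')`. -/
def CruxAt (red : Valued.integer (PadicAlgCl p) →+* k) (σ σ' : FramedGaloisRep ℚ k 2) : Prop :=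
  AutGL2 red σ → AutGL2 red σ' → σ.toGaloisRep.IsIrreducible → σ'.toGaloisRep.IsIrreducible →
    DetCond p σ σ' → NonConj σ σ' → (∃ ρ : FramedGaloisRep ℚ (PadicAlgCl p) 4, Sh red σ σ' ρ) →
      ∀ (hcpt : isCompact_glFiniteIntegralLevel 4 ℚ) (ι : PadicAlgCl p ≃+* ℂ),
        ∃ ρ₀ : FramedGaloisRep ℚ (PadicAlgCl p) 4,
          ρ₀.toGaloisRep.IsIrreducible ∧ Sh red σ σ' ρ₀ ∧ AutGL4 p hcpt ι ρ₀

end Names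

/-- The crux is literally `∀ p ≠ 2, ∀ k red σ σ', CruxAt p k red σ σ'` (the route's `let`s zeta-reduce
to the named pieces; same `Iff.rfl` as Disproof.lean `crux_iff`). -/
theorem crux_iff :
    StableYoshidaCongruence ↔
      ∀ (p : ℕ) [Fact p.Prime], p ≠ 2 → ∀ (k : Type) [Field k] [CharP k p] [IsAlgClosed k]
        [TopologicalSpace k] [DiscreteTopology k] (red : Valued.integer (PadicAlgCl p) →+* k)
        (σ σ' : FramedGaloisRep ℚ k 2), CruxAt p k red σ σ' :=
  Iff.rfl

/-! ## Vocabulary II — the Klingen weight line, automorphic weights, wall models -/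

section Wall

variable (p : ℕ) [Fact p.Prime] (k : Type) [Field k] [CharP k p] [TopologicalSpace k]
  [DiscreteTopology k]

/-- `Wt p` — the KLINGEN WEIGHT LINE through `𝔪`: indices `m ≥ 1` with `m ≡ 1 (mod p-1)`, i.e. Siegel
weights `(k,2) = (m+1, 2)` with `k ≡ 2 (mod p-1)` (the `Λ_I`-component of BCGP arXiv:1812.09269 held-text
Thm 156 (3), `I = {p}`, `F = ℚ`: `k_v ≡ l_v ≡ 2 (mod p-1)`) — the only weights at which a lift with
multiplier `ε^{-m}` can be residually `σ ⊕ σ'` with `det σ = det σ' = ε̄⁻¹`.  The wall is `m = 1`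
(`one_mem_Wt`); the line is infinite (`m = 1 + n(p-1)`), and `k = m+1` is even (`p` odd), as algebraicity
requires. -/
def Wt : Set ℕ := {m : ℕ | 1 ≤ m ∧ (p - 1) ∣ (m - 1)}

variable {p k}

variable (p) in
/-- `AutWt red σ σ' m` — WEIGHT `m` IS AUTOMORPHIC for the pair (level free): for every `hcpt, ι` some
`ShW m`-shaped `r` is cuspidal-automorphic on `GL₄`.  `AutWt … 1` is the crux's conclusion with
irreducibility dropped (`autWt_one_iff`). -/
def AutWt (red : Valued.integer (PadicAlgCl p) →+* k) (σ σ' : FramedGaloisRep ℚ k 2) (m : ℕ) : Prop :=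
  ∀ (hcpt : isCompact_glFiniteIntegralLevel 4 ℚ) (ι : PadicAlgCl p ≃+* ℂ),
    ∃ r : FramedGaloisRep ℚ (PadicAlgCl p) 4, ShW p red σ σ' m r ∧ AutGL4 p hcpt ι r

variable (p) in
/-- `Fam red σ σ' S m` — WEIGHT `m` IS AUTOMORPHIC AT LEVEL `S`: as `AutWt`, with `r` moreover unramified at
every finite place outside the finite set `S` and not above `p` (hence of tame conductor dividing a bound
`N(S, σ̄, σ̄')`: Swan conductors are residual, tame exponents `≤ 4`).  The FAMILY SECTOR of the line is
"`{m ∈ Wt p | Fam … S m}` is infinite for some `S`" — the Galois shadow of `rank_{Λ₁} H⁰(M_𝔪) > 0` at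
tame level `K(N(S))`; conjecturally (Deo–Palvannan arXiv:2602.20737) exactly the functorial pairs of
Disproof §5 R1/D1. -/
def Fam (red : Valued.integer (PadicAlgCl p) →+* k) (σ σ' : FramedGaloisRep ℚ k 2)
    (S : Finset (HeightOneSpectrum (NumberField.RingOfIntegers ℚ))) (m : ℕ) : Prop :=
  ∀ (hcpt : isCompact_glFiniteIntegralLevel 4 ℚ) (ι : PadicAlgCl p ≃+* ℂ),
    ∃ r : FramedGaloisRep ℚ (PadicAlgCl p) 4, ShW p red σ σ' m r ∧ AutGL4 p hcpt ι r ∧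
      ∀ v : HeightOneSpectrum (NumberField.RingOfIntegers ℚ), v ∉ S →
        ((p : ℕ) : NumberField.RingOfIntegers ℚ) ∉ v.asIdeal → r.IsUnramifiedAt v

/-- `HasPoint d π` — the two-term complex `[M --d--> N]` HAS A POINT AT `π`: `ker(d mod π) ≠ 0`, i.e. some
`x ∈ M ∖ πM` has `d x ∈ πN` (elementary spelling, no quotient modules).  For the Klingen wall model this
is `H⁰(M_𝔪 ⊗^L_{Λ₁} Λ₁/π)[1/p] ≠ 0` (the universal-coefficient sequence
`0 → H⁰(M_𝔪)/π → H⁰(M_𝔪 ⊗^L Λ₁/π) → H¹(M_𝔪)[π] → 0`, `pd(Λ₁/π) = 1`), i.e. by BCGP classicality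
(held-text Thm 255) "a classical cuspidal Klingen-ordinary eigenform of weight `π` at `𝔪`". -/
def HasPoint {R M N : Type} [CommRing R] [AddCommGroup M] [Module R M] [AddCommGroup N] [Module R N]
    (d : M →ₗ[R] N) (π : R) : Prop :=
  ∃ x : M, (¬ ∃ y : M, x = π • y) ∧ ∃ z : N, d x = π • z

/-- `IsWallModel W A F d ϖ` — `[M --d--> N]` with weight elements `ϖ : ℕ → R` is a WALL MODEL for the
weight line `W` with forward dictionary `A` ("weight `m` automorphic") and converse dictionary `F`
("weight `m` automorphic at the model's level"):
(w1) `ϖ m` is a non-unit for `m ∈ W`;  (w2) the `ϖ m`, `m ∈ W`, are pairwise coprime;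
(a) a point at `ϖ m` makes weight `m` automorphic;  (a') an automorphic weight at the model's level gives a
point at `ϖ m`.  (For the genuine model (a) is classicality + purity + Galois representations + transfer,
and (a') is descent; see `stub_klingenWallModel`.) -/
def IsWallModel {R M N : Type} [CommRing R] [AddCommGroup M] [Module R M] [AddCommGroup N]
    [Module R N] (W : Set ℕ) (A F : ℕ → Prop) (d : M →ₗ[R] N) (ϖ : ℕ → R) : Prop :=
  (∀ m ∈ W, ¬ IsUnit (ϖ m)) ∧
  (∀ m ∈ W, ∀ m' ∈ W, m ≠ m' → IsCoprime (ϖ m) (ϖ m')) ∧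
  (∀ m ∈ W, HasPoint d (ϖ m) → A m) ∧
  (∀ m ∈ W, F m → HasPoint d (ϖ m))

end Wall

/-! ## Small sorry-free facts about the vocabulary -/

section Facts

variable {p : ℕ} [Fact p.Prime] {k : Type} [Field k] [CharP k p] [TopologicalSpace k]
  [DiscreteTopology k]

omit [Fact p.Prime] in
/-- The wall weight `(2,2)` is on the Klingen line. -/
theorem one_mem_Wt : 1 ∈ Wt p := ⟨le_rfl, dvd_zero _⟩

omit [CharP k p] [DiscreteTopology k] in
/-- `ShW … 1 r ↔ Sh … r` (`x ^ 1 = x`). -/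
theorem shW_one_iff {red : Valued.integer (PadicAlgCl p) →+* k} {σ σ' : FramedGaloisRep ℚ k 2}
    {r : FramedGaloisRep ℚ (PadicAlgCl p) 4} : ShW p red σ σ' 1 r ↔ Sh red σ σ' r := by
  simp only [ShW, Sh, pow_one]

omit [CharP k p] [DiscreteTopology k] in
/-- `AutWt … 1` is the crux's conclusion with irreducibility dropped. -/
theorem autWt_one_iff {red : Valued.integer (PadicAlgCl p) →+* k} {σ σ' : FramedGaloisRep ℚ k 2} :
    AutWt p red σ σ' 1 ↔
      ∀ (hcpt : isCompact_glFiniteIntegralLevel 4 ℚ) (ι : PadicAlgCl p ≃+* ℂ),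
        ∃ r : FramedGaloisRep ℚ (PadicAlgCl p) 4, Sh red σ σ' r ∧ AutGL4 p hcpt ι r :=
  forall_congr' fun _ => forall_congr' fun _ => exists_congr fun _ => and_congr_left' shW_one_iff

end Facts

/-! ## Stub 1 — the Klingen wall model at a Yoshida maximal ideal (construction + two-way dictionary) -/

/-- **Stub 1 (`stub_klingenWallModel`, XL; (a) IN PRINT modulo named facts, (a') a RECIPROCITY FRAGMENT —
the soft spot).**  Let `p` be odd, `(σ, σ')` an eligible pair (crux hypotheses: `AutGL2`, irreducible,
`det σ = det σ' = ε̄⁻¹`, non-conjugate, an `Sh`-witness — so `(σ̄, σ̄')` is an ordinary `p`-DISTINGUISHED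
Yoshida pair, Disproof §4: this is where H5 is consumed) which is NOT a cyclotomic-twist pair
(`¬ TwistEps`), and `S` a finite set of finite places.  Then there is a WALL MODEL at level `S`: a PID `R`,
finite free `R`-modules `M, N`, `d : M →ₗ N`, and weight elements `ϖ : ℕ → R` with `IsWallModel (Wt p)
(AutWt p red σ σ') (Fam p red σ σ' S) d ϖ`.
INTENDED MODEL.  `N(S) :=` the largest conductor away from `p` of a 4-dimensional `p`-adic `ρ` of `Γ_ℚ`
unramified outside `S ∪ {p}` with `ρ̄^ss ≅ σ̄ ⊕ σ̄'` (finite: Swan conductors are read off `ρ̄|_{P_ℓ}`, tame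
exponents `≤ 4`); `𝒪 := W(k₀)[eigenvalues]`, `Λ := 𝒪⟦T⟧` (the `k ≡ 2 (mod p-1)` component of the Klingen
weight space, `T ↔ [1+p]-1`), `R := Λ[1/p]` — a PID (regular local of dimension 2 ⇒ UFD; inverting `p`
leaves dimension 1); `𝔪 :=` the maximal ideal of the anemic Hecke algebra (good places `∉ S ∪ {p}`, plus
`U_{Kli(p),1}, U_{p,2}`) cut out by `(σ̄ ⊕ σ̄', red)` and the ORDINARY `U`-eigenvalues dictated by the
`Sh`-witness; `M_𝔪 :=` the `𝔪`-localisation (a direct summand) of BCGP's `M_I = e(U^I) RΓ(𝔛^{G_1,I}_{K,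
Kli(p^∞)}, Ω^{κ_I}(-D))`, `I = {p}`, tame level `K^p = K(N(S))` PARAMODULAR (if a neat `K^p_1 ◁ K(N(S))` of
index prime to `p` is needed, take `K(N(S))`-invariants — an exact functor, so still perfect of amplitude
`[0,1]`), represented by finite free `F⁰ → F¹` over `Λ` (perfect of amplitude `[0,1]` over a local ring);
`M := F⁰[1/p]`, `N := F¹[1/p]`, `d := ∂[1/p]`; `ϖ m := T - ((1+p)^{m-1} - 1)` (the weight `(m+1, 2)`;
pairwise differences are `p`-adic units times powers of `p`, units in `R`: (w1), (w2)).
(a) POINT ⇒ AUTOMORPHIC WEIGHT, sub-lemmas: (a.1) `HasPoint d (ϖ m)` ⇔ `H⁰(M_𝔪 ⊗^L_Λ Λ/ϖ_m)[1/p] ≠ 0`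
(universal coefficients, `pd = 1`; localisation is exact); (a.2) CLASSICALITY at every Klingen weight
including the wall: `H⁰(M_I ⊗^L κ_{(k,2)})[1/p] = e(U^I) H⁰(X^{G_1}_{K^pK_p(I)}, ω^{(k,2)}(-D))[1/p]`
(arXiv:1812.09269 held-text Thm 255, `#I ≤ 1`, `l_v = 2`; p. 103: the Katz–Mazur / Euler-characteristic
remarks there put a localisation "in force in the rest of the paper" — at a Yoshida `𝔪`, which is
EISENSTEIN in BCGP's sense (`ρ̄_𝔪` reducible, p. 44), boundary vanishing and Katz–Mazur must be re-derived:
triage r1-2 (iv) / S3, a line item of this stub), so a point is a nonzero `𝔪`-eigenspace of classical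
HOLOMORPHIC cuspidal Klingen-ordinary forms of weight `(m+1,2)`, level `K(N(S))K_p(I)`, containing a Hecke
eigenform `Π` (commuting operators on a finite-dimensional space); (a.3) SIGN PURITY (K1, the card's lever):
`Π` is of GENERAL type — by held-text Lemma 48 a non-general `Π` with this infinitesimal character is of
type (b) Yoshida `μ₁ ⊞ μ₂` (holomorphic weight-`k` forms, tempered everywhere: then `Π_∞` holomorphic =
the non-generic member of the archimedean packet, and Arthur's multiplicity formula (held-text Thm 50 /
Gee–Taïbi, `⟨·, π⟩ = ε_ψ = 1`) demands an odd number of FINITE non-generic places; but a tempered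
non-generic `Π_q` is not paramodular (JLRS LNM 2342 Thm 2.3.3 "tempered: paramodular iff generic",
Roberts–Schmidt LNM 1918 §7.5) and at `p` the only tempered non-generic Iwahori-spherical representation
`VIb` has no `Kli(p)`-vectors (Schmidt 2005 Table 3 / Roberts–Schmidt Table A.15: `0 0 0 1 1`), `Va`'s
partner being supercuspidal — contradiction), (c) Soudry `μ|·|^{1/2} ⊞ μ|·|^{-1/2}` (residually
`σ̄_μ ⊕ σ̄_μ ε̄^{∓1}`, equal determinants force `ε̄² = 1`: excluded by `¬TwistEps` / `p ≥ 5`), (d)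
Saito–Kurokawa and (e), (f) (one-dimensional residual constituents: excluded, `σ̄, σ̄'` irreducible,
Brauer–Nesbitt); (a.4) GALOIS: `ρ_{Π,p}` (Taylor 1991 / Laumon / Weissauer; low weight: Mok 2014 =
[MR3200667], held-text Thm 40 and Remark 49), valued in `GSp₄` with `ν = ε⁻¹` (Bellaïche–Chenevier sign),
twisted by `ε^{1-k/2}`: multiplier `ε^{-m}`; Klingen-ORDINARY and `p`-distinguished `𝔪` ⇒ Greenberg
frame `(λ_α, λ_β, λ_β⁻¹ε^{-m}, λ_α⁻¹ε^{-m})` (held-text Thm 41 shape in cohomological weight, moved to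
`(k,2)` along the Hida family: Tilouine–Urban, Pilloni 2012, BCGP §7; semistable = zeros on inertia) and
`IsResiduallyDistinguishedAt` from the pair's distinguishedness (H5); residual pair `(σ̄, σ̄')` through
`red` because `Π ≡ 𝔪`; symplecticity of a FRAMED `ρ` with multiplier exactly `ε^{-m}`: for irreducible
`ρ_{Π,p}` (expected for general type, Remark 49; it follows from the Fontaine–Mazur / Jacquet–Shalika argument
of Stub 3 off Stub 3's small-image residue) by the Bellaïche–Chenevier sign, the reducible sub-case being
part of that documented residue; (a.5) TRANSFER: general type ⇒ cuspidal L-algebraic `π_ι` on `GL₄(𝔸_ℚ)`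
for every `ι` (Arthur 2004 / Gee–Taïbi 2019 = held-text Thm 50; the classical space is defined over `ℚ̄`,
so `ι ∘ θ` is a classical eigensystem for every `ι`) with `arithFrobPolyOfSatake ι q_v 1` matching —
the route-wide normalisation debt shared with `SerreKWAutomorphicGL2`.
(a') AUTOMORPHIC WEIGHT AT LEVEL `S` ⇒ POINT — THE SOFT SPOT.  Given `r` `ShW m`-shaped, unramified
outside `S ∪ {p}`, and a cuspidal L-algebraic `π` on `GL₄` with a.e. Satake matching: (a'.1) `π ≅ π^∨ ⊗ χ`
(Satake multisets a.e. + strong multiplicity one, Jacquet–Shalika); (a'.2) `π` is of SYMPLECTIC type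
(`L^S(s, π, ∧² ⊗ χ⁻¹)` has a pole) and descends to a general-type `Π` on `GSp₄` (held-text Thm 50) —
NOT deducible today from the symplecticity of `r` alone (the Galois side gives `∧² r ⊗ ε^m ⊇ 1` but no
analytic control of `L^S(s, r, std₅)` at `s = 1`); (a'.3) `Π_∞` lies in the `(m+1, 2)` limit-of-discrete-
series packet — i.e. the ARCHIMEDEAN parameter of `π` is read off the Hodge–Tate shape of `r`: known only
when `π` is regular algebraic (then `ρ_{π}` exists and its weights contradict `(0,0,m,m)`), open for
non-regular `π`; (a'.4) the holomorphic member `Π_f ⊗ Π_∞^{hol}` is automorphic (general type: stable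
packet, every member occurs, Thm 50), has `K(N(S))`-vectors (paramodular new/oldform theory,
Roberts–Schmidt; the CONDUCTOR of `Π` is bounded by `S` only through local–global compatibility INCLUDING
monodromy at `v ∉ S`, again open in low weight) and is Klingen-ordinary at `p` (Greenberg shape ⇒ unit
`U`-eigenvalues, local–global at `p`); then its `𝔪`-eigenclass is a point at `ϖ m` by (a.1)–(a.2).
(a'.2)–(a'.4) are fragments of reciprocity for NON-REGULAR `π` — true under the summit's own conjunct (A)+(B)
with archimedean compatibility, not in print.  In the functorial examples (twist families
`ρ_{f_k}^∨ ⊗ Ind φ`, theta/automorphic-induction families from real quadratic fields = the expected whole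
of the family sector) they hold by construction (Johnson-Leung–Roberts lifts).
LOGICAL STATUS.  Given Stub 2, this stub is EQUIVALENT to the Galois-side weight dichotomy
`familyDichotomy` below (⇒: proved below; ⇐: if `Fam S` is finite take `d` injective with
`coker d ≅ ⊕_{m ∈ Fam S} R/ϖ_m`, if every weight is automorphic take `d = 0` on `M = R`) — a prover may
land it in either form; the intended proof is the genuine model above.  NOT implied by the crux (which
constrains the wall weight only).  WHY IT MIGHT FAIL: only through (a') (a "phantom" symplectic-type
cuspidal `π` on `GL₄`, Satake-matched with an `ShW m`-shaped `r` at bounded level for infinitely many `m`,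
whose `GSp₄`-descent is not holomorphic of weight `(m+1,2)` at level `K(N(S))Kli(p)`) or through the S3
localisation caveat in (a.2).  Size: XL (named facts: BCGP Thm 156/255, Lemma 48, Thm 50; JLRS 2.3.3;
Mok 2014; Hida theory for `GSp₄`) + L (dictionary) + the open (a').
LEANS ON: `IsWallModel`/`HasPoint`/`Wt`/`AutWt`/`Fam`/`ShW` (this file, definitional over the tree),
`FramedGaloisRep.IsSymplecticWithMultiplierFun`, `IsGreenbergOrdinaryOfShapeAt`, `IsResiduallyDistinguishedAt`,
`HasFrobCharpolyAt`, `IsUnramifiedAt`, `CuspidalAutomorphicRepData`, `IsLAlgebraic`, `HasSatakeParamAt`,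
`arithFrobPolyOfSatake`, Mathlib `Module.Free`/`Module.Finite`/`IsPrincipalIdealRing`/`IsCoprime`.
[cite: BoxerEtAl2021 = arXiv:1812.09269, Thm 4.6.1 (held-text Thm 156), §6.5 Thm 255 (p. 103), §2.7 Thm 40–41,
§2.9 Lemma 48, Thm 50; Pilloni2020 (Duke 169), Thm 1.1–1.2; JohnsonLeungRobertsSchmidt2023 = LNM 2342, Thm 2.3.3, Table 1.4;
RobertsSchmidt2007 = LNM 1918 (doi:10.1007/978-3-540-73324-9), §7.5, Table A.15; Schmidt2005 (doi:10.2969/jmsj/1158242058), Table 3;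
Schmidt2018 (doi:10.1090/tran/7028); Schmidt2020 (Acta Arith. 194, paramodular forms in CAP representations);
Arthur2004; GeeTaibi2019; Taylor1991 (Duke 63:281); Mok2014 (Compositio 150:523); TilouineUrban1999; Pilloni2012 (BSMF 140);
JacquetShalika1981 (doi:10.2307/2374050); Kim2003 (exterior square); JohnsonLeungRoberts2012 (JNT 132); DeoPalvannan2026 = arXiv:2602.20737;
HsiehPalvannan2025 = arXiv:2505.09975] -/
theorem stub_klingenWallModel :
    ∀ (p : ℕ) [Fact p.Prime], p ≠ 2 → ∀ (k : Type) [Field k] [CharP k p] [IsAlgClosed k]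
      [TopologicalSpace k] [DiscreteTopology k] (red : Valued.integer (PadicAlgCl p) →+* k)
      (σ σ' : FramedGaloisRep ℚ k 2),
      AutGL2 red σ → AutGL2 red σ' → σ.toGaloisRep.IsIrreducible → σ'.toGaloisRep.IsIrreducible →
      DetCond p σ σ' → NonConj σ σ' → (∃ ρ : FramedGaloisRep ℚ (PadicAlgCl p) 4, Sh red σ σ' ρ) →
      ¬ TwistEps p σ σ' →
      ∀ S : Finset (HeightOneSpectrum (NumberField.RingOfIntegers ℚ)),
        ∃ (R : Type) (_ : CommRing R) (_ : IsDomain R) (_ : IsPrincipalIdealRing R)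
          (M : Type) (_ : AddCommGroup M) (_ : Module R M) (_ : Module.Finite R M) (_ : Module.Free R M)
          (N : Type) (_ : AddCommGroup N) (_ : Module R N) (_ : Module.Finite R N) (_ : Module.Free R N)
          (d : M →ₗ[R] N) (ϖ : ℕ → R),
          IsWallModel (Wt p) (AutWt p red σ σ') (Fam p red σ σ' S) d ϖ := by
  sorry

/-! ## Stub 2 — rank propagation for two-term free complexes over a PID — LANDED

**LANDED** (lead c2, wave 1, 2026-08-16, worker a55b…): p118861 ACCEPTED,
`Summits/Langlands/Langlands/Theorems/PhantomRMYoshidaStableYoshidaCongruenceRankPropagation.lean`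
(177 lines, commit 7e587f8bf3a8, axioms propext/Classical.choice/Quot.sound) declares
`stub_rankPropagation` in THIS namespace with the registered signature (imported above), plus the
reusable helpers `false_of_infinite_not_isCoprime`, `exists_ne_zero_smul_torsion_eq_zero`,
`not_isCoprime_of_point`.  The registered statement is kept below as a comment for the record. -/

/- **Stub 2 (`stub_rankPropagation`, M/L, PROVABLE NOW; pure commutative algebra, Mathlib only — the
card's `KerFullSupport` upgraded with the "infinitely many weights ⇒ positive rank" direction demanded by
triage r1-2 (i) / r1-3 (1)).**  Let `R` be a PID (a domain), `M, N` finite free `R`-modules,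
`d : M →ₗ[R] N`, `W ⊆ ℕ` and `ϖ : ℕ → R` with `ϖ m` a NON-UNIT for `m ∈ W` and the `ϖ m`, `m ∈ W`,
PAIRWISE COPRIME.  If the complex `[M --d--> N]` has a point at `ϖ m` (some `x ∉ ϖ_m M` with
`d x ∈ ϖ_m N`) for INFINITELY many `m ∈ W`, then it has a point at EVERY non-unit `π ∈ R`.
WHY TRUE: put `H⁰ = ker d`, `H¹ = N / d(M)`.  A point at `ϖ` is a nonzero element of
`ker(M/ϖM → N/ϖN)`, which sits in `0 → H⁰/ϖH⁰ → ker(M/ϖ → N/ϖ) → H¹[ϖ] → 0` (`im d ⊂ N` is torsion-free,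
so `Tor₁(im d, R/ϖ) = 0`; snake lemma).  If `H⁰ = 0` (i.e. `d` injective): a point `x` at `ϖ_m` gives
`d x = ϖ_m z` with `z ∉ d(M)` (else `x ∈ ϖ_m M` by injectivity), so `z̄ ∈ H¹` is nonzero `ϖ_m`-torsion; the
torsion submodule of the finitely generated `H¹` has a nonzero annihilator `a` (domain, Noetherian), and
`IsCoprime ϖ_m a` would give `z̄ = (uϖ_m + va) z̄ = 0`; so infinitely many pairwise coprime non-units `ϖ_m`
are each non-coprime to `a ≠ 0`, i.e. lie in pairwise DISTINCT maximal ideals all containing `a` — but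
`a` lies in only finitely many maximal ideals (`R` Dedekind: `Ideal.finite_factors`; or `R/(a)` Artinian).
Hence `H⁰ ≠ 0`; as a submodule of the free module `M` over a PID it is free of positive rank
(`Submodule.basisOfPid` / `Module.free_of_finite_type_torsion_free'`), so for a non-unit `π` a basis vector
`e` of `H⁰` is a point at `π`: `d e = 0 = π • 0`, and `e = π y` would force `d y = 0` (`N` torsion-free;
`π ≠ 0` — and `π = 0` means `e = 0`), `y ∈ H⁰`, and then `π` divides a basis vector inside the free module
`H⁰`, making `π` a unit.  Size: M/L in Lean (~300–600 lines: snake-type bookkeeping by hand, structure of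
finitely generated modules over a PID, finiteness of the maximal ideals above `a ≠ 0`).  First deliverable
of the line; lands as `Theorems/StableYoshidaCongruenceRankPropagation.lean --supports stmt-Langlands-13640`.
LEANS ON (Mathlib): `Module.Free`, `Module.Finite`, `IsPrincipalIdealRing`, `IsCoprime`,
`Submodule.basisOfPid`, `Module.Finite.of_injective`, `Submodule.exists_annihilator…`/`Module.IsTorsion`,
`Ideal.finite_factors`, `Set.Infinite.mono`, `Set.infinite_coe_iff`.
[cite: Bourbaki, Algèbre commutative VII §4 (modules over principal ideal domains); BoxerEtAl2021 §4.6 (Nakayama/universal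
coefficients for perfect complexes of amplitude [0,1], held-text p. 66–72); Matsumura CRT Thm 6.5 (finiteness of Ass)]
```
    theorem stub_rankPropagation :
    ∀ (R : Type) [CommRing R] [IsDomain R] [IsPrincipalIdealRing R]
      (M : Type) [AddCommGroup M] [Module R M] [Module.Finite R M] [Module.Free R M]
      (N : Type) [AddCommGroup N] [Module R N] [Module.Finite R N] [Module.Free R N]
      (d : M →ₗ[R] N) (W : Set ℕ) (ϖ : ℕ → R),
      (∀ m ∈ W, ¬ IsUnit (ϖ m)) →
      (∀ m ∈ W, ∀ m' ∈ W, m ≠ m' → IsCoprime (ϖ m) (ϖ m')) →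
      Set.Infinite {m : ℕ | m ∈ W ∧ ∃ x : M, (¬ ∃ y : M, x = ϖ m • y) ∧ ∃ z : N, d x = ϖ m • z} →
      ∀ π : R, ¬ IsUnit π → ∃ x : M, (¬ ∃ y : M, x = π • y) ∧ ∃ z : N, d x = π • z
```
-/

/-! ## Stub 3 — irreducibility of a cuspidal `GL₄`-automorphic `Sh`-shaped representation (SHARED stub)

**RESHAPED by lead c2 (2026-08-16), identically to the sibling skeleton `serre_dual_ribet_square.lean`:** the Galois-side half
"every non-trivial proper invariant subspace is a plane" is LANDED (`SerreDualRibetSquare.stub_invariantSubspaceFinrankTwo`, p123140,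
imported above) and the remaining Fontaine–Mazur / Jacquet–Shalika core is `stub_irreducibleOfCuspidalGL4_ofShape` (3b, blocked on facts
ABSENT from the tree — see `Lines/paramodular-purity-torsion-locus-dead.md`); the registered shared statement is proved from them. -/

/-- **Stub 3b (`stub_irreducibleOfCuspidalGL4_ofShape`; BLOCKED on absent facts).**  Stub 3 with the conclusion of the landed 3a as an EXTRA hypothesis (last antecedent); byte-identical to the sibling skeleton's 3b.  Original description of Stub 3 (`stub_irreducibleOfCuspidalGL4`; L modulo named facts; VERBATIM the sibling line
`serre-dual-ribet-square`'s Stub 3 — same name, same statement, so that ONE landing serves both lines).**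
Let `p` be odd, `σ, σ' : Γ_ℚ → GL₂(k)` irreducible with `det σ = det σ' = ε̄⁻¹`, and `ρ₀ : Γ_ℚ → GL₄(ℚ̄_p)`
symplectic with multiplier `ε⁻¹`, Greenberg-ordinary of shape `(0,0,1,1)` and residually distinguished at
`p`, with a.e. Frobenius polynomials `p`-integral reducing to `charpoly σ · charpoly σ'`, and AUTOMORPHIC:
Satake parameters of an L-algebraic cuspidal `π` on `GL₄(𝔸_ℚ)` match its Frobenius polynomials a.e.  Then
`ρ₀` is irreducible.  Why: a proper invariant subspace has dimension `2` (residual constituents `σ̄, σ̄'`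
are irreducible of dimension `2`, Brauer–Nesbitt), giving `ρ₁ ⊂ ρ₀ ↠ ρ₂`, both de Rham at `p` (ordinary
of this shape ⇒ semistable) with Hodge–Tate types `{0,1}|{0,1}` or `{0,0}|{1,1}` (or its dual); in the
first case `ρ₁, ρ₂` are modular of weight 2 (Kisin's Fontaine–Mazur theorem; `ρ̄_i ∈ {σ̄, σ̄'}` odd
irreducible, `p` odd), in the second `ρ₁` (resp. `ρ₂ ⊗ ε`) has finite image on `I_p` (Sen) and is odd,
hence modular of weight one (Pilloni–Stroh); either way `π` and an isobaric sum `π₁ ⊞ π₂` share Satake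
parameters at almost all places, contradicting Jacquet–Shalika.  Why it might fail / residue: `p = 3` or
`σ̄|_{Γ_{ℚ(ζ_p)}}` not absolutely irreducible (hypotheses of the Fontaine–Mazur theorems); these are the
documented small-image cases, where Tung / Pan-type extensions are needed.  In THIS line it is applied to
the weight-`(2,2)` output of `familyDichotomy` / Stub 4 (triage r1-2 (ii), r1-3 (3): "irreducibility is
almost free, not free — the shared route debt").  Size: L (modulo the named facts Kisin FM, Pilloni–Stroh,
Jacquet–Shalika, which enter as cited Literature Props).
[cite: Kisin2009 (= doi:10.1090/S0894-0347-09-00628-6, the Fontaine–Mazur conjecture for GL₂), Thm;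
Pilloni–Stroh, *Surconvergence, ramification et modularité*, Astérisque 382 (2016), Thm 1.1 (weight-one
Fontaine–Mazur); Jacquet–Shalika, *On Euler products and the classification of automorphic forms II*,
Amer. J. Math. 103 (1981) = doi:10.2307/2374050, Thm 4.4; arXiv:2603.19768] -/
theorem stub_irreducibleOfCuspidalGL4_ofShape :
    ∀ (p : ℕ) [Fact p.Prime], p ≠ 2 → ∀ (k : Type) [Field k] [CharP k p] [IsAlgClosed k]
      [TopologicalSpace k] [DiscreteTopology k] (red : Valued.integer (PadicAlgCl p) →+* k)
      (σ σ' : FramedGaloisRep ℚ k 2)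
      (hcpt : isCompact_glFiniteIntegralLevel 4 ℚ) (ι : PadicAlgCl p ≃+* ℂ)
      (ρ₀ : FramedGaloisRep ℚ (PadicAlgCl p) 4),
      let εb : Field.absoluteGaloisGroup ℚ →* (ZMod p)ˣ :=
        (modularCyclotomicCharacter (AlgebraicClosure ℚ)
          (HasEnoughRootsOfUnity.natCard_rootsOfUnity (AlgebraicClosure ℚ) p)).comp
          (MulSemiringAction.toRingAut (Field.absoluteGaloisGroup ℚ) (AlgebraicClosure ℚ))
      let Sh := fun r : FramedGaloisRep ℚ (PadicAlgCl p) 4 =>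
        (r.IsSymplecticWithMultiplierFun (fun g => algebraMap ℚ_[p] (PadicAlgCl p)
          ((((GaloisRep.cyclotomicCharacter ℚ p g)⁻¹ : ℤ_[p]ˣ) : ℤ_[p]) : ℚ_[p])) ∧
        (∀ v : HeightOneSpectrum (NumberField.RingOfIntegers ℚ),
          ((p : ℕ) : NumberField.RingOfIntegers ℚ) ∈ v.asIdeal →
            r.IsGreenbergOrdinaryOfShapeAt v ![0, 0, 1, 1] ∧ r.IsResiduallyDistinguishedAt v ![0, 0, 1, 1]) ∧
        (∀ᶠ v : HeightOneSpectrum (NumberField.RingOfIntegers ℚ) in Filter.cofinite,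
          r.IsUnramifiedAt v ∧ σ.IsUnramifiedAt v ∧ σ'.IsUnramifiedAt v ∧
          ∃ (P : Polynomial (Valued.integer (PadicAlgCl p))) (P₁ P₂ : Polynomial k),
            r.HasFrobCharpolyAt v (P.map (Valued.integer (PadicAlgCl p)).subtype) ∧
            σ.HasFrobCharpolyAt v P₁ ∧ σ'.HasFrobCharpolyAt v P₂ ∧ P.map red = P₁ * P₂))
      let AutGL4 := fun r : FramedGaloisRep ℚ (PadicAlgCl p) 4 =>
        (∃ π : CuspidalAutomorphicRepData 4 ℚ hcpt, π.1.IsLAlgebraic ∧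
          ∀ᶠ v : HeightOneSpectrum (NumberField.RingOfIntegers ℚ) in Filter.cofinite,
            ∃ a : Multiset ℂ, π.1.HasSatakeParamAt v a ∧ r.IsUnramifiedAt v ∧
              r.HasFrobCharpolyAt v (arithFrobPolyOfSatake ι v.residueCard 1 a))
      σ.toGaloisRep.IsIrreducible → σ'.toGaloisRep.IsIrreducible →
      (∀ g, FramedRep.det σ g = (Units.map (ZMod.castHom (dvd_refl p) k).toMonoidHom (εb g))⁻¹ ∧
        FramedRep.det σ' g = FramedRep.det σ g) →
      Sh ρ₀ → AutGL4 ρ₀ →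
      (∀ W : Submodule (PadicAlgCl p) (Fin 4 → PadicAlgCl p),
        (∀ g : Field.absoluteGaloisGroup ℚ, ∀ x ∈ W,
          ((ρ₀ g : GL (Fin 4) (PadicAlgCl p)) : Matrix (Fin 4) (Fin 4) (PadicAlgCl p)).mulVec x ∈ W) →
        W ≠ ⊥ → W ≠ ⊤ → Module.finrank (PadicAlgCl p) W = 2) →
      ρ₀.toGaloisRep.IsIrreducible := by
  sorry

/-- **Stub 3 (`stub_irreducibleOfCuspidalGL4`, the registered shared statement) — PROVED from the landed 3a + Stub 3b.** -/
theorem stub_irreducibleOfCuspidalGL4 :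
    ∀ (p : ℕ) [Fact p.Prime], p ≠ 2 → ∀ (k : Type) [Field k] [CharP k p] [IsAlgClosed k]
      [TopologicalSpace k] [DiscreteTopology k] (red : Valued.integer (PadicAlgCl p) →+* k)
      (σ σ' : FramedGaloisRep ℚ k 2)
      (hcpt : isCompact_glFiniteIntegralLevel 4 ℚ) (ι : PadicAlgCl p ≃+* ℂ)
      (ρ₀ : FramedGaloisRep ℚ (PadicAlgCl p) 4),
      let εb : Field.absoluteGaloisGroup ℚ →* (ZMod p)ˣ :=
        (modularCyclotomicCharacter (AlgebraicClosure ℚ)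
          (HasEnoughRootsOfUnity.natCard_rootsOfUnity (AlgebraicClosure ℚ) p)).comp
          (MulSemiringAction.toRingAut (Field.absoluteGaloisGroup ℚ) (AlgebraicClosure ℚ))
      let Sh := fun r : FramedGaloisRep ℚ (PadicAlgCl p) 4 =>
        (r.IsSymplecticWithMultiplierFun (fun g => algebraMap ℚ_[p] (PadicAlgCl p)
          ((((GaloisRep.cyclotomicCharacter ℚ p g)⁻¹ : ℤ_[p]ˣ) : ℤ_[p]) : ℚ_[p])) ∧
        (∀ v : HeightOneSpectrum (NumberField.RingOfIntegers ℚ),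
          ((p : ℕ) : NumberField.RingOfIntegers ℚ) ∈ v.asIdeal →
            r.IsGreenbergOrdinaryOfShapeAt v ![0, 0, 1, 1] ∧ r.IsResiduallyDistinguishedAt v ![0, 0, 1, 1]) ∧
        (∀ᶠ v : HeightOneSpectrum (NumberField.RingOfIntegers ℚ) in Filter.cofinite,
          r.IsUnramifiedAt v ∧ σ.IsUnramifiedAt v ∧ σ'.IsUnramifiedAt v ∧
          ∃ (P : Polynomial (Valued.integer (PadicAlgCl p))) (P₁ P₂ : Polynomial k),
            r.HasFrobCharpolyAt v (P.map (Valued.integer (PadicAlgCl p)).subtype) ∧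
            σ.HasFrobCharpolyAt v P₁ ∧ σ'.HasFrobCharpolyAt v P₂ ∧ P.map red = P₁ * P₂))
      let AutGL4 := fun r : FramedGaloisRep ℚ (PadicAlgCl p) 4 =>
        (∃ π : CuspidalAutomorphicRepData 4 ℚ hcpt, π.1.IsLAlgebraic ∧
          ∀ᶠ v : HeightOneSpectrum (NumberField.RingOfIntegers ℚ) in Filter.cofinite,
            ∃ a : Multiset ℂ, π.1.HasSatakeParamAt v a ∧ r.IsUnramifiedAt v ∧
              r.HasFrobCharpolyAt v (arithFrobPolyOfSatake ι v.residueCard 1 a))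
      σ.toGaloisRep.IsIrreducible → σ'.toGaloisRep.IsIrreducible →
      (∀ g, FramedRep.det σ g = (Units.map (ZMod.castHom (dvd_refl p) k).toMonoidHom (εb g))⁻¹ ∧
        FramedRep.det σ' g = FramedRep.det σ g) →
      Sh ρ₀ → AutGL4 ρ₀ → ρ₀.toGaloisRep.IsIrreducible := by
  intro p _ hp k _ _ _ _ _ red σ σ' hcpt ι ρ₀ εb Sh AutGL4 hirr hirr' hdet hSh hAut
  exact stub_irreducibleOfCuspidalGL4_ofShape p hp k red σ σ' hcpt ι ρ₀ hirr hirr' hdet hSh hAut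
    (SerreDualRibetSquare.stub_invariantSubspaceFinrankTwo p k red σ σ' ρ₀ hirr hirr' hSh.2.2)

/-! ## Stub 4 — the HONEST REMAINDER: isolated accidents off the family sector (open, not attacked) -/

/-- **Stub 4 (`stub_offFamilyRemainder`, OPEN — the remainder this line does NOT attack; the crux's hard
core in its sharpened "torsion alternative" form).**  For an eligible pair (crux hypotheses) OFF the family
sector — i.e. a cyclotomic-twist pair (`TwistEps`, `p = 3`), or a pair with only FINITELY MANY automorphic
Klingen weights at every finite level `S` — the wall weight is automorphic: `AutWt p red σ σ' 1` (an
`Sh`-shaped `ρ₀`, cuspidal-automorphic on `GL₄`, for every `hcpt, ι`; irreducibility is Stub 3).  In the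
model this is the TORSION ALTERNATIVE `ϖ₁ ∈ Supp H¹(M_𝔪)[1/p]_{tors}` at some paramodular level — an
ISOLATED classical point at the wall ("accident": an abelian surface / `GSp₄`-type abelian variety over `ℚ`
with `A[𝔭]^ss ≅ σ̄ ⊕ σ̄'` and good ordinary reduction at `p`, or a sporadic stable weight-2 paramodular
newform `≡ 𝔪`), with no family through it.  Equivalently: the crux restricted off the sector (so it is
implied by the crux; it is weaker than `CruxAt` only by the irreducibility conjunct and the sector
hypothesis).  STATUS: open both ways.  Expected dimension of the deformation problem is `-1` independently
of the auxiliary level (Disproof §6), so at fixed level accidents are rare and for `p ≥ 5` the motivic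
supply is thin (`A₂(n)`-twists are of general type for `n ≥ 4`, Yamazaki / Hulek–Sankaran; Disproof R4);
but the level is FREE, the number of "attempts" (new components, growing Hecke fields = `GSp₄`-type abelian
varieties of growing dimension) is infinite, and no obstruction is known (Disproof §6: "neither a
construction nor an obstruction"; no parity phenomenon on the stable side, R5).  Provable sub-cases belong
to other mechanisms: `p = 3` with an `𝔽₃`-symplectic switchable model (sibling lines
`level-three-weierstrass-switch ≈ burkhardt-weddle-two-three-anchor`, BCGP2025 Lemma 9.4.2 + Thm 8.3; that
covers part of the `TwistEps` locus too), a cross-ratio Ribet square (`serre-dual-ribet-square`'s C⁺).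
Decidable PER LEVEL by finite computation (dimensions of weight-2 paramodular cusp form spaces at `𝔪`;
LMFDB / Poor–Yuen tables for prime level `< 600`), which can only FIND accidents.  A RIGID PAIR (Disproof
§3.4) off the sector refutes it and the crux with it.  The lead should not try to prove it inside this line:
hand it back (`promote-stub`), or let the tenure planner restate the item (`Irr'`, Disproof `closes_irr'`).
Size: open (XL⁺).
[cite: DeoPalvannan2026 = arXiv:2602.20737; HsiehPalvannan2025 = arXiv:2505.09975 §1.5–1.6; PoorYuen2015 = arXiv:0912.0049 Thm 1.2;
BrumerKramer2014 (paramodular conjecture, doi:10.1090/S0002-9947-2013-05909-0); BoxerCalegariGeePilloni2025 = arXiv:2502.20645 Lemma 9.4.2;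
HulekSankaran2002; Sorensen2006; Sorensen2009; LemmaOchiai2023] -/
theorem stub_offFamilyRemainder :
    ∀ (p : ℕ) [Fact p.Prime], p ≠ 2 → ∀ (k : Type) [Field k] [CharP k p] [IsAlgClosed k]
      [TopologicalSpace k] [DiscreteTopology k] (red : Valued.integer (PadicAlgCl p) →+* k)
      (σ σ' : FramedGaloisRep ℚ k 2),
      AutGL2 red σ → AutGL2 red σ' → σ.toGaloisRep.IsIrreducible → σ'.toGaloisRep.IsIrreducible →
      DetCond p σ σ' → NonConj σ σ' → (∃ ρ : FramedGaloisRep ℚ (PadicAlgCl p) 4, Sh red σ σ' ρ) →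
      ¬ (¬ TwistEps p σ σ' ∧
          ∃ S : Finset (HeightOneSpectrum (NumberField.RingOfIntegers ℚ)),
            Set.Infinite {m : ℕ | m ∈ Wt p ∧ Fam p red σ σ' S m}) →
      AutWt p red σ σ' 1 := by
  sorry

/-! ## Glue (sorry-free): the weight dichotomy from Stubs 1–2, and the crux from the four stubs -/

/-- **A wall model at level `S` forces the weight dichotomy at level `S`** (sorry-free from the LANDED
Stub 2): EITHER only finitely many Klingen weights are automorphic at level `S`, OR every Klingen weight
`m ∈ Wt p` is automorphic.  Proof: if infinitely many weights are automorphic at level `S`, the converse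
dictionary (a') of the wall model turns them into points at infinitely many pairwise coprime `ϖ m`, rank
propagation (Stub 2, p118861) gives a point at every non-unit `ϖ m`, `m ∈ Wt p`, and the forward
dictionary (a) makes every such weight automorphic. -/
theorem dichotomy_of_isWallModel {p : ℕ} [Fact p.Prime] {k : Type} [Field k]
    [TopologicalSpace k] {red : Valued.integer (PadicAlgCl p) →+* k}
    {σ σ' : FramedGaloisRep ℚ k 2} {S : Finset (HeightOneSpectrum (NumberField.RingOfIntegers ℚ))}
    {R : Type} [CommRing R] [IsDomain R] [IsPrincipalIdealRing R]
    {M : Type} [AddCommGroup M] [Module R M] [Module.Finite R M] [Module.Free R M]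
    {N : Type} [AddCommGroup N] [Module R N] [Module.Finite R N] [Module.Free R N]
    {d : M →ₗ[R] N} {ϖ : ℕ → R}
    (hW : IsWallModel (Wt p) (AutWt p red σ σ') (Fam p red σ σ' S) d ϖ) :
    Set.Finite {m : ℕ | m ∈ Wt p ∧ Fam p red σ σ' S m} ∨ ∀ m ∈ Wt p, AutWt p red σ σ' m := by
  by_cases hinf : Set.Infinite {m : ℕ | m ∈ Wt p ∧ Fam p red σ σ' S m}
  · right
    obtain ⟨hunit, hcop, ha, ha'⟩ := hW
    have hpts : Set.Infinite
        {m : ℕ | m ∈ Wt p ∧ ∃ x : M, (¬ ∃ y : M, x = ϖ m • y) ∧ ∃ z : N, d x = ϖ m • z} :=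
      hinf.mono fun m hm => ⟨hm.1, ha' m hm.1 hm.2⟩
    intro m hm
    exact ha m hm (stub_rankPropagation R M N d (Wt p) ϖ hunit hcop hpts (ϖ m) (hunit m hm))
  · left
    exact Set.not_infinite.mp hinf

/-! ### Lead c2 certificate: Stub 1 is EQUIVALENT to the weight dichotomy (fake models)

The two theorems below make the planner's "LOGICAL STATUS" remark a checked fact: at a fixed level `S`,
a wall model exists iff the dichotomy holds (⇒ is `dichotomy_of_isWallModel`, using the landed Stub 2; ⇐ is
`isWallModel_of_dichotomy`, by two explicit models over `R = ℚ[X]` with `ϖ m = X - m`: if the automorphic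
weights at level `S` form a FINITE set `F`, take `d =` multiplication by `∏_{m ∈ F} (X - m)` on `M = N = R`,
whose points on the Klingen line are exactly `F`; if EVERY Klingen weight is automorphic, take `d = 0`).
Consequently `stub_klingenWallModel` carries NO algebraic content beyond Stub 2: the line's lever is exactly
the implication "infinitely many automorphic Klingen weights at bounded level ⇒ all Klingen weights
automorphic", whose converse-dictionary half (a′) has no source in print (see the line's dead note). -/

section Certificate

open Polynomial

variable {p : ℕ} [Fact p.Prime] {k : Type} [Field k] [CharP k p] [TopologicalSpace k]
  [DiscreteTopology k]

omit [CharP k p] [DiscreteTopology k] in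
/-- `Fam S m → AutWt m`: drop the level clause. -/
theorem autWt_of_fam {red : Valued.integer (PadicAlgCl p) →+* k} {σ σ' : FramedGaloisRep ℚ k 2}
    {S : Finset (HeightOneSpectrum (NumberField.RingOfIntegers ℚ))} {m : ℕ}
    (h : Fam p red σ σ' S m) : AutWt p red σ σ' m := fun hcpt ι => by
  obtain ⟨r, hr, hA, -⟩ := h hcpt ι
  exact ⟨r, hr, hA⟩

/-- In `ℚ[X]`, `1` is not a multiple of the non-unit `X - C q`. -/
theorem one_ne_X_sub_C_smul (q : ℚ) : ¬ ∃ y : ℚ[X], (1 : ℚ[X]) = (X - C q) • y := by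
  rintro ⟨y, hy⟩
  exact Polynomial.not_isUnit_X_sub_C q (IsUnit.of_mul_eq_one y hy.symm)

/-- The weight elements `ϖ m = X - C m` of `ℚ[X]` are pairwise coprime non-units. -/
theorem wallWeights_coprime {m m' : ℕ} (h : m ≠ m') :
    IsCoprime (X - C (m : ℚ)) (X - C (m' : ℚ)) :=
  Polynomial.pairwise_coprime_X_sub_C (s := fun n : ℕ => (n : ℚ)) Nat.cast_injective h

omit [CharP k p] [DiscreteTopology k] in
/-- **Stub 1 ⇐ dichotomy (the fake models).**  If at level `S` the automorphic Klingen weights are finitely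
many, or every Klingen weight is automorphic, then a wall model at level `S` exists — over `R = ℚ[X]`,
`M = N = R`, `ϖ m = X - m`, with `d =` multiplication by `∏_{m ∈ F} (X - m)` (resp. `d = 0`). -/
theorem isWallModel_of_dichotomy (red : Valued.integer (PadicAlgCl p) →+* k)
    (σ σ' : FramedGaloisRep ℚ k 2) (S : Finset (HeightOneSpectrum (NumberField.RingOfIntegers ℚ)))
    (h : Set.Finite {m : ℕ | m ∈ Wt p ∧ Fam p red σ σ' S m} ∨ ∀ m ∈ Wt p, AutWt p red σ σ' m) :
    ∃ (R : Type) (_ : CommRing R) (_ : IsDomain R) (_ : IsPrincipalIdealRing R)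
      (M : Type) (_ : AddCommGroup M) (_ : Module R M) (_ : Module.Finite R M) (_ : Module.Free R M)
      (N : Type) (_ : AddCommGroup N) (_ : Module R N) (_ : Module.Finite R N) (_ : Module.Free R N)
      (d : M →ₗ[R] N) (ϖ : ℕ → R),
      IsWallModel (Wt p) (AutWt p red σ σ') (Fam p red σ σ' S) d ϖ := by
  -- common data: `R = M = N = ℚ[X]`, `ϖ m = X - m`
  have hw1 : ∀ m ∈ Wt p, ¬ IsUnit (X - C (m : ℚ)) := fun m _ => Polynomial.not_isUnit_X_sub_C _
  have hw2 : ∀ m ∈ Wt p, ∀ m' ∈ Wt p, m ≠ m' → IsCoprime (X - C (m : ℚ)) (X - C (m' : ℚ)) :=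
    fun m _ m' _ hmm => wallWeights_coprime hmm
  rcases h with hfin | hall
  · -- finite branch: `d` = multiplication by `f = ∏_{m ∈ F} (X - m)`
    set F : Finset ℕ := hfin.toFinset with hF
    set f : ℚ[X] := ∏ m ∈ F, (X - C (m : ℚ)) with hf
    refine ⟨ℚ[X], inferInstance, inferInstance, inferInstance, ℚ[X], inferInstance, inferInstance,
      inferInstance, inferInstance, ℚ[X], inferInstance, inferInstance, inferInstance, inferInstance,
      LinearMap.mulLeft ℚ[X] f, fun m => X - C (m : ℚ), hw1, hw2, ?_, ?_⟩
    · -- (a) a point at `X - m` forces `m ∈ F`, hence `Fam S m`, hence `AutWt m`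
      intro m hm hpt
      obtain ⟨x, hx, z, hz⟩ := hpt
      rw [LinearMap.mulLeft_apply, smul_eq_mul] at hz
      have hmF : m ∈ F := by
        by_contra hmF
        have hcop : IsCoprime (X - C (m : ℚ)) f := by
          refine IsCoprime.prod_right fun m' hm' => wallWeights_coprime ?_
          rintro rfl
          exact hmF hm'
        have hdvd : (X - C (m : ℚ)) ∣ f * x := ⟨z, hz⟩
        obtain ⟨y, hy⟩ := hcop.dvd_of_dvd_mul_left hdvd
        exact hx ⟨y, by rw [smul_eq_mul, hy]⟩
      exact autWt_of_fam ((Set.Finite.mem_toFinset hfin).mp hmF).2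
    · -- (a') `Fam S m` puts `m` in `F`, so `X - m ∣ f` and `x = 1` is a point
      intro m hm hfam
      have hmF : m ∈ F := (Set.Finite.mem_toFinset hfin).mpr ⟨hm, hfam⟩
      obtain ⟨g, hg⟩ : (X - C (m : ℚ)) ∣ f := Finset.dvd_prod_of_mem _ hmF
      exact ⟨1, one_ne_X_sub_C_smul _, g, by rw [LinearMap.mulLeft_apply, mul_one, smul_eq_mul, hg]⟩
  · -- "all weights" branch: `d = 0`, every non-unit has the point `x = 1`
    refine ⟨ℚ[X], inferInstance, inferInstance, inferInstance, ℚ[X], inferInstance, inferInstance,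
      inferInstance, inferInstance, ℚ[X], inferInstance, inferInstance, inferInstance, inferInstance,
      0, fun m => X - C (m : ℚ), hw1, hw2, fun m hm _ => hall m hm, ?_⟩
    intro m _ _
    exact ⟨1, one_ne_X_sub_C_smul _, 0, by rw [LinearMap.zero_apply, smul_zero]⟩

omit [CharP k p] [DiscreteTopology k] in
/-- **Stub 1 ⟺ dichotomy, level by level** (given the landed Stub 2).  The existence of a wall model at
level `S` is equivalent to: finitely many automorphic Klingen weights at level `S`, or all Klingen weights
automorphic.  Hence `stub_klingenWallModel` is exactly the statement that this dichotomy holds for every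
eligible non-`TwistEps` pair and every `S` — the line's genuine (and unsourced) content. -/
theorem exists_isWallModel_iff_dichotomy (red : Valued.integer (PadicAlgCl p) →+* k)
    (σ σ' : FramedGaloisRep ℚ k 2) (S : Finset (HeightOneSpectrum (NumberField.RingOfIntegers ℚ))) :
    (∃ (R : Type) (_ : CommRing R) (_ : IsDomain R) (_ : IsPrincipalIdealRing R)
      (M : Type) (_ : AddCommGroup M) (_ : Module R M) (_ : Module.Finite R M) (_ : Module.Free R M)
      (N : Type) (_ : AddCommGroup N) (_ : Module R N) (_ : Module.Finite R N) (_ : Module.Free R N)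
      (d : M →ₗ[R] N) (ϖ : ℕ → R),
      IsWallModel (Wt p) (AutWt p red σ σ') (Fam p red σ σ' S) d ϖ) ↔
    (Set.Finite {m : ℕ | m ∈ Wt p ∧ Fam p red σ σ' S m} ∨ ∀ m ∈ Wt p, AutWt p red σ σ' m) := by
  constructor
  · rintro ⟨R, _, _, _, M, _, _, _, _, N, _, _, _, _, d, ϖ, hW⟩
    exact dichotomy_of_isWallModel hW
  · exact isWallModel_of_dichotomy red σ σ' S

end Certificate

/-- **The WEIGHT DICHOTOMY (sorry-free from Stubs 1–2) — the Galois-side content of the wall transfer.**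
For an eligible pair off `TwistEps` and a finite level `S`: EITHER only finitely many Klingen weights are
automorphic at level `S`, OR every Klingen weight `m ∈ Wt p` is automorphic (at some level) — in
particular the wall `m = 1`.  Proof: the wall model of Stub 1 at level `S` and `dichotomy_of_isWallModel`
(rank propagation, Stub 2, landed p118861). -/
theorem familyDichotomy (p : ℕ) [Fact p.Prime] (hp : p ≠ 2) (k : Type) [Field k] [CharP k p]
    [IsAlgClosed k] [TopologicalSpace k] [DiscreteTopology k] (red : Valued.integer (PadicAlgCl p) →+* k)
    (σ σ' : FramedGaloisRep ℚ k 2) (hA : AutGL2 red σ) (hA' : AutGL2 red σ')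
    (hirr : σ.toGaloisRep.IsIrreducible) (hirr' : σ'.toGaloisRep.IsIrreducible) (hdet : DetCond p σ σ')
    (hnc : NonConj σ σ') (hw : ∃ ρ : FramedGaloisRep ℚ (PadicAlgCl p) 4, Sh red σ σ' ρ)
    (htw : ¬ TwistEps p σ σ') (S : Finset (HeightOneSpectrum (NumberField.RingOfIntegers ℚ))) :
    Set.Finite {m : ℕ | m ∈ Wt p ∧ Fam p red σ σ' S m} ∨ ∀ m ∈ Wt p, AutWt p red σ σ' m := by
  obtain ⟨R, _, _, _, M, _, _, _, _, N, _, _, _, _, d, ϖ, hW⟩ :=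
    stub_klingenWallModel p hp k red σ σ' hA hA' hirr hirr' hdet hnc hw htw S
  exact dichotomy_of_isWallModel hW

/-- **`StableYoshidaCongruence` from the line `paramodular-purity-torsion-locus`.**  Regime split on the
FAMILY SECTOR `¬TwistEps ∧ ∃ S, {m ∈ Wt p | Fam S m} infinite`.  IN the sector: the weight dichotomy
(Stubs 1–2) cannot take its finite branch, so every Klingen weight — in particular the wall `m = 1` — is
automorphic: an `Sh`-shaped automorphic `ρ₀` of weight `(2,2)`; Stub 3 makes it irreducible.  OFF the
sector: Stub 4 (the honest remainder), then Stub 3. -/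
theorem StableYoshidaCongruence_of : StableYoshidaCongruence := by
  refine crux_iff.mpr fun p _ hp k _ _ _ _ _ red σ σ' => ?_
  intro hA hA' hirr hirr' hdet hnc hw hcpt ι
  have hwall : AutWt p red σ σ' 1 := by
    by_cases hsec : ¬ TwistEps p σ σ' ∧
        ∃ S : Finset (HeightOneSpectrum (NumberField.RingOfIntegers ℚ)),
          Set.Infinite {m : ℕ | m ∈ Wt p ∧ Fam p red σ σ' S m}
    · obtain ⟨htw, S, hinf⟩ := hsec
      rcases familyDichotomy p hp k red σ σ' hA hA' hirr hirr' hdet hnc hw htw S with hfin | hall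
      · exact absurd hfin hinf
      · exact hall 1 one_mem_Wt
    · exact stub_offFamilyRemainder p hp k red σ σ' hA hA' hirr hirr' hdet hnc hw hsec
  obtain ⟨ρ₀, hSh, hAut⟩ := autWt_one_iff.mp hwall hcpt ι
  exact ⟨ρ₀, stub_irreducibleOfCuspidalGL4 p hp k red σ σ' hcpt ι ρ₀ hirr hirr' hdet hSh hAut,
    hSh, hAut⟩

end Summit.Langlands.Langlands.Cruxes.StableYoshidaCongruence.ParamodularPurityTorsionLocus

end
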